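import Summits.AtomisticToContinuum.Crystallization.Theorems.PalmUnimodularRigidityLayeredLawsSelectHcpUniqueMinimiser

/-!
# `StackingHinge` (stmt-AtomisticToContinuum-14993), line `Sketch`: stub `stub_shapeModulus`

The shape function `G = S₃²/S₆` of the certified hcp lattice sums `S_n = hcpSumS n`
(`…CoarseGrainsPinSums`) has a global maximiser `c₀ ∈ (39/50, 17/20)` on `(0, ∞)` with a QUADRATIC
MODULUS on the box `[39/50, 17/20]`: `G(c) + μ (c − c₀)² ≤ G(c₀)`.

Proof.
* `c₀ = h₀/a₀` for the global minimiser `(a₀, h₀)` of `hcpE` (`stub_relaxedReference`,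
  `hcpE_globalMin_shape`, `shape_globalMax_mem_box`).
* Abstract calculus lemma `shapeModulus_of_fermat`: on `[a, b] ⊂ (0, ∞)` with `S₃' = −6x D₃`,
  `S₆' = −12x D₆`, the Fermat function `F = S₆D₃ − S₃D₆` vanishes at an interior maximiser `c₀` of `G`
  (`G' = −(12 x S₃/S₆²) F`, Fermat), `F' ≥ m > 0` gives `F(x) ≥ m (x − c₀)` to the right and
  `F(x) ≤ m (x − c₀)` to the left of `c₀`, and with `12 x S₃/S₆² ≥ w > 0` the function
  `G + (w m/2)(· − c₀)²` is monotone on `[a, c₀]` and antitone on `[c₀, b]`.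
* Concretely `F' = x (14 S₃E₆ − 8 S₆E₃ − 6 D₃D₆) > 0` on `[7/10, 9/10]` (`shape_fermat_pos`,
  `hcpSumS_hasDerivAt`, `hcpSumD_hasDerivAt`); it is continuous (the `E_n = hcpSumW 2 (n+2)` are
  differentiable by `hcpW_hasDerivAt_tsum` with `m = 2`), so compactness gives `m`; and
  `12 x S₃/S₆² ≥ 12 (39/50)/S₆(39/50)²` by `S₃ ≥ 1` and antitonicity of `S₆`.

All `[folklore]` real analysis; no new numerics.
-/

noncomputable section

namespace Summit.AtomisticToContinuum.Crystallization.Theorems.PricedHcpWindowsShapeModulus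

open Set
open Summit.AtomisticToContinuum.Crystallization.Theorems.ExcessDecayLiouvilleCoarseGrains
open Summit.AtomisticToContinuum.Crystallization.Theorems.EkelandSurgeryParityUniq
open Summit.AtomisticToContinuum.Crystallization.Theorems.PalmUnimodularRigidity.LayeredLawsSelectHcp

/-! ## The abstract modulus lemma -/

/-- **Quadratic modulus from the Fermat function.**  On `[a, b]` with `0 < a`, let `S₃, S₆ > 0` have
`S₃' = −6x D₃`, `S₆' = −12x D₆`, let the Fermat function `F = S₆D₃ − S₃D₆` have derivative `F' ≥ m > 0`,
let `12 x S₃/S₆² ≥ w > 0`, and let `c₀ ∈ (a, b)` maximise `G = S₃²/S₆` on `[a, b]`.  Then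
`G(x) + (w m/2)(x − c₀)² ≤ G(c₀)` on `[a, b]`: `F(c₀) = 0` (Fermat, `G' = −(12xS₃/S₆²) F`),
`F − m·id` is monotone, and `G + (w m/2)(· − c₀)²` is monotone on `[a, c₀]`, antitone on `[c₀, b]`.
[folklore] -/
theorem shapeModulus_of_fermat {a b c₀ m w : ℝ} (ha : 0 < a) (hc₀ : c₀ ∈ Ioo a b) (hm : 0 < m)
    (hw : 0 < w) {S₃ S₆ D₃ D₆ F' : ℝ → ℝ}
    (h3 : ∀ x ∈ Icc a b, HasDerivAt S₃ (-(2 * 3 * x) * D₃ x) x)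
    (h6 : ∀ x ∈ Icc a b, HasDerivAt S₆ (-(2 * 6 * x) * D₆ x) x)
    (hS₃ : ∀ x ∈ Icc a b, 0 < S₃ x) (hS₆ : ∀ x ∈ Icc a b, 0 < S₆ x)
    (hF : ∀ x ∈ Icc a b, HasDerivAt (fun t => S₆ t * D₃ t - S₃ t * D₆ t) (F' x) x)
    (hF' : ∀ x ∈ Icc a b, m ≤ F' x)
    (hwle : ∀ x ∈ Icc a b, w ≤ 12 * x * S₃ x / S₆ x ^ 2)
    (hmax : ∀ x ∈ Icc a b, S₃ x ^ 2 / S₆ x ≤ S₃ c₀ ^ 2 / S₆ c₀) :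
    ∀ x ∈ Icc a b, S₃ x ^ 2 / S₆ x + w * m / 2 * (x - c₀) ^ 2 ≤ S₃ c₀ ^ 2 / S₆ c₀ := by
  have hc₀I : c₀ ∈ Icc a b := Ioo_subset_Icc_self hc₀
  -- the derivative of `G` is `-(12 x S₃/S₆²) F`
  have hGd : ∀ x ∈ Icc a b, HasDerivAt (fun t => S₃ t ^ 2 / S₆ t)
      (-(12 * x * S₃ x / S₆ x ^ 2) * (S₆ x * D₃ x - S₃ x * D₆ x)) x := by
    intro x hx
    refine (shapeG_hasDerivAt (h3 x hx) (h6 x hx) (hS₆ x hx).ne').congr_deriv ?_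
    ring
  -- Fermat: `F c₀ = 0`
  have hF0 : S₆ c₀ * D₃ c₀ - S₃ c₀ * D₆ c₀ = 0 := by
    have hloc : IsLocalMax (fun t => S₃ t ^ 2 / S₆ t) c₀ :=
      (isMaxOn_iff.2 hmax).isLocalMax (Icc_mem_nhds hc₀.1 hc₀.2)
    have h0 := hloc.hasDerivAt_eq_zero (hGd c₀ hc₀I)
    have hc₀pos : 0 < c₀ := ha.trans hc₀.1
    have h3p := hS₃ c₀ hc₀I
    have h6p := hS₆ c₀ hc₀I
    have hk : 12 * c₀ * S₃ c₀ / S₆ c₀ ^ 2 ≠ 0 := by positivity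
    rcases mul_eq_zero.1 h0 with h | h
    · exact absurd (neg_eq_zero.1 h) hk
    · exact h
  -- `F - m·id` is monotone on `[a, b]`
  have hψd : ∀ x ∈ Icc a b,
      HasDerivAt (fun t => S₆ t * D₃ t - S₃ t * D₆ t - m * t) (F' x - m) x := by
    intro x hx
    have h1 : HasDerivAt (fun t : ℝ => m * t) m x := by
      simpa using (hasDerivAt_id' x).const_mul m
    exact (hF x hx).fun_sub h1
  have hψ : MonotoneOn (fun t => S₆ t * D₃ t - S₃ t * D₆ t - m * t) (Icc a b) := by
    refine monotoneOn_of_hasDerivWithinAt_nonneg (convex_Icc a b) (f' := fun x => F' x - m)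
      (fun x hx => (hψd x hx).continuousAt.continuousWithinAt)
      (fun x hx => (hψd x (interior_subset hx)).hasDerivWithinAt) fun x hx => ?_
    have := hF' x (interior_subset hx)
    simp only [sub_nonneg]
    exact this
  have hright : ∀ x ∈ Icc a b, c₀ ≤ x → m * (x - c₀) ≤ S₆ x * D₃ x - S₃ x * D₆ x := by
    intro x hx hcx
    have := hψ hc₀I hx hcx
    simp only at this
    linarith
  have hleft : ∀ x ∈ Icc a b, x ≤ c₀ → S₆ x * D₃ x - S₃ x * D₆ x ≤ m * (x - c₀) := by
    intro x hx hxc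
    have := hψ hx hc₀I hxc
    simp only at this
    linarith
  -- the modulus function `φ = G + (w m/2)(· - c₀)²` and its derivative
  have hφd : ∀ x ∈ Icc a b, HasDerivAt (fun t => S₃ t ^ 2 / S₆ t + w * m / 2 * (t - c₀) ^ 2)
      (-(12 * x * S₃ x / S₆ x ^ 2) * (S₆ x * D₃ x - S₃ x * D₆ x) + w * m * (x - c₀)) x := by
    intro x hx
    have h2 : HasDerivAt (fun t : ℝ => (t - c₀) ^ 2) (2 * (x - c₀)) x := by
      simpa using ((hasDerivAt_id' x).fun_sub (hasDerivAt_const x c₀)).fun_pow 2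
    refine ((hGd x hx).fun_add (h2.const_mul (w * m / 2))).congr_deriv ?_
    ring
  -- antitone to the right of `c₀`
  have hanti : AntitoneOn (fun t => S₃ t ^ 2 / S₆ t + w * m / 2 * (t - c₀) ^ 2) (Icc c₀ b) := by
    have hsub : Icc c₀ b ⊆ Icc a b := Icc_subset_Icc_left hc₀.1.le
    refine antitoneOn_of_hasDerivWithinAt_nonpos (convex_Icc c₀ b)
      (f' := fun x => -(12 * x * S₃ x / S₆ x ^ 2) * (S₆ x * D₃ x - S₃ x * D₆ x) + w * m * (x - c₀))
      (fun x hx => (hφd x (hsub hx)).continuousAt.continuousWithinAt)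
      (fun x hx => (hφd x (hsub (interior_subset hx))).hasDerivWithinAt) fun x hx => ?_
    rw [interior_Icc] at hx
    have hxI : x ∈ Icc a b := hsub (Ioo_subset_Icc_self hx)
    have hFx := hright x hxI hx.1.le
    have hk := hwle x hxI
    have hmx : 0 ≤ m * (x - c₀) := mul_nonneg hm.le (by linarith [hx.1])
    have hFx0 : 0 ≤ S₆ x * D₃ x - S₃ x * D₆ x := hmx.trans hFx
    have e1 := mul_le_mul_of_nonneg_right hk hFx0
    have e2 := mul_le_mul_of_nonneg_left hFx hw.le
    nlinarith [e1, e2]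
  -- monotone to the left of `c₀`
  have hmono : MonotoneOn (fun t => S₃ t ^ 2 / S₆ t + w * m / 2 * (t - c₀) ^ 2) (Icc a c₀) := by
    have hsub : Icc a c₀ ⊆ Icc a b := Icc_subset_Icc_right hc₀.2.le
    refine monotoneOn_of_hasDerivWithinAt_nonneg (convex_Icc a c₀)
      (f' := fun x => -(12 * x * S₃ x / S₆ x ^ 2) * (S₆ x * D₃ x - S₃ x * D₆ x) + w * m * (x - c₀))
      (fun x hx => (hφd x (hsub hx)).continuousAt.continuousWithinAt)
      (fun x hx => (hφd x (hsub (interior_subset hx))).hasDerivWithinAt) fun x hx => ?_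
    rw [interior_Icc] at hx
    have hxI : x ∈ Icc a b := hsub (Ioo_subset_Icc_self hx)
    have hFx := hleft x hxI hx.2.le
    have hk := hwle x hxI
    have hmx : m * (x - c₀) ≤ 0 := mul_nonpos_of_nonneg_of_nonpos hm.le (by linarith [hx.2])
    have hFx0 : S₆ x * D₃ x - S₃ x * D₆ x ≤ 0 := hFx.trans hmx
    have e1 := mul_le_mul_of_nonpos_right hk hFx0
    have e2 := mul_le_mul_of_nonneg_left hFx hw.le
    nlinarith [e1, e2]
  -- assembly
  intro x hx
  rcases le_total c₀ x with hcx | hxc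
  · have := hanti (left_mem_Icc.2 hc₀.2.le) ⟨hcx, hx.2⟩ hcx
    simpa using this
  · have := hmono ⟨hx.1, hxc⟩ (right_mem_Icc.2 hc₀.1.le) hxc
    simpa using this

/-! ## The maximiser of the shape function -/

/-- **A global maximiser of `S₃²/S₆` on `(0, ∞)` exists and lies in `(39/50, 17/20)`**: the layer
ratio `c₀ = h₀/a₀` of the global minimiser of `hcpE` (`stub_relaxedReference`,
`hcpE_globalMin_shape`, `shape_globalMax_mem_box`). [folklore] -/
theorem shapeModulus_globalMax : ∃ c₀ : ℝ, 39 / 50 < c₀ ∧ c₀ < 17 / 20 ∧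
    ∀ c : ℝ, 0 < c → hcpSumS 3 c ^ 2 / hcpSumS 6 c ≤ hcpSumS 3 c₀ ^ 2 / hcpSumS 6 c₀ := by
  obtain ⟨a₀, h₀, ha1, -, hh1, -, hmin⟩ := stub_relaxedReference
  have ha₀ : 0 < a₀ := by linarith
  have hh₀ : 0 < h₀ := by linarith
  have hc₀ : 0 < h₀ / a₀ := div_pos hh₀ ha₀
  have hmin' : ∀ a h : ℝ, 0 < a → 0 < h → hcpE a₀ (a₀ * (h₀ / a₀)) ≤ hcpE a h := by
    rw [mul_div_cancel₀ h₀ ha₀.ne']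
    exact hmin
  obtain ⟨-, hglob⟩ := hcpE_globalMin_shape ha₀ hc₀ hmin'
  obtain ⟨hl, hr⟩ := shape_globalMax_mem_box hc₀ hglob
  exact ⟨h₀ / a₀, hl, hr, hglob⟩

/-! ## Derivatives and continuity of the six sums on the box -/

/-- **`E_n = hcpSumW 2 (n+2)` is differentiable** (hence continuous) at every `c > 0`, `n ≥ 3`:
weighted term-wise differentiation `hcpW_hasDerivAt_tsum` with weight `(k²)²`. [folklore] -/
theorem shapeModulus_hcpSumE_hasDerivAt (e : ℕ) (he : 3 ≤ e) {c : ℝ} (hc : 0 < c) :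
    HasDerivAt (hcpSumW 2 (e + 2)) (-(2 * (e + 2 : ℕ) * c) * hcpSumW 3 (e + 3) c) c :=
  hcpW_hasDerivAt_tsum (Q := hcpSumQ) hcpSumQ_nonneg hcpSumQ_pos_layer_zero 2 (e + 2) hc
    (hcpSumW_summable_gen (m := 2) (e := e + 2) (by omega) (by omega) (half_pos hc))
    (hcpSumW_summable_gen (m := 2) (e := e + 2) (by omega) (by omega) hc)

/-! ## The statement -/

/-- **Stub `stub_shapeModulus` of line `Sketch` (crux `StackingHinge`, stmt-AtomisticToContinuum-14993):
QUADRATIC MODULUS OF THE hcp SHAPE FUNCTION.**  The shape function `G = S₃²/S₆` of the certified hcp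
lattice sums has a global maximiser `c₀ ∈ (39/50, 17/20)` on `(0, ∞)` and `G(c) + μ (c − c₀)² ≤ G(c₀)`
on `[39/50, 17/20]` for some `μ > 0`: the abstract lemma `shapeModulus_of_fermat` fed with the
certified positivity `shape_fermat_pos` of `F'/x` (compactness gives `F' ≥ m > 0` on the box), the
derivative relations `hcpSumS_hasDerivAt`, `hcpSumD_hasDerivAt`, and `12xS₃/S₆² ≥ 12·(39/50)/S₆(39/50)²`.
[folklore] -/
theorem stub_shapeModulus : ∃ c₀ μ : ℝ, 39 / 50 < c₀ ∧ c₀ < 17 / 20 ∧ 0 < μ ∧ (∀ c : ℝ, 0 < c → Summit.AtomisticToContinuum.Crystallization.Theorems.ExcessDecayLiouvilleCoarseGrains.hcpSumS 3 c ^ 2 / Summit.AtomisticToContinuum.Crystallization.Theorems.ExcessDecayLiouvilleCoarseGrains.hcpSumS 6 c ≤ Summit.AtomisticToContinuum.Crystallization.Theorems.ExcessDecayLiouvilleCoarseGrains.hcpSumS 3 c₀ ^ 2 / Summit.AtomisticToContinuum.Crystallization.Theorems.ExcessDecayLiouvilleCoarseGrains.hcpSumS 6 c₀) ∧ ∀ c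 : ℝ, 39 / 50 ≤ c → c ≤ 17 / 20 → Summit.AtomisticToContinuum.Crystallization.Theorems.ExcessDecayLiouvilleCoarseGrains.hcpSumS 3 c ^ 2 / Summit.AtomisticToContinuum.Crystallization.Theorems.ExcessDecayLiouvilleCoarseGrains.hcpSumS 6 c + μ * (c - c₀) ^ 2 ≤ Summit.AtomisticToContinuum.Crystallization.Theorems.ExcessDecayLiouvilleCoarseGrains.hcpSumS 3 c₀ ^ 2 / Summit.AtomisticToContinuum.Crystallization.Theorems.ExcessDecayLiouvilleCoarseGrains.hcpSumS 6 c₀ := by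
  obtain ⟨c₀, hl, hr, hglob⟩ := shapeModulus_globalMax
  have ha : (0 : ℝ) < 39 / 50 := by norm_num
  have hI : ∀ x ∈ Icc (39 / 50 : ℝ) (17 / 20), 0 < x ∧ 7 / 10 ≤ x ∧ x ≤ 9 / 10 :=
    fun x hx => ⟨by linarith [hx.1], by linarith [hx.1], by linarith [hx.2]⟩
  -- the derivative relations on the box
  have h3 : ∀ x ∈ Icc (39 / 50 : ℝ) (17 / 20),
      HasDerivAt (hcpSumS 3) (-(2 * 3 * x) * hcpSumW 1 4 x) x :=
    fun x hx => by simpa using hcpSumS_hasDerivAt (e := 3) le_rfl (hI x hx).1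
  have h6 : ∀ x ∈ Icc (39 / 50 : ℝ) (17 / 20),
      HasDerivAt (hcpSumS 6) (-(2 * 6 * x) * hcpSumW 1 7 x) x :=
    fun x hx => by simpa using hcpSumS_hasDerivAt (e := 6) (by norm_num) (hI x hx).1
  have hd3 : ∀ x ∈ Icc (39 / 50 : ℝ) (17 / 20),
      HasDerivAt (hcpSumW 1 4) (-(2 * 4 * x) * hcpSumW 2 5 x) x :=
    fun x hx => by simpa using hcpSumD_hasDerivAt 3 le_rfl (hI x hx).1
  have hd6 : ∀ x ∈ Icc (39 / 50 : ℝ) (17 / 20),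
      HasDerivAt (hcpSumW 1 7) (-(2 * 7 * x) * hcpSumW 2 8 x) x :=
    fun x hx => by simpa using hcpSumD_hasDerivAt 6 (by norm_num) (hI x hx).1
  have he3 : ∀ x ∈ Icc (39 / 50 : ℝ) (17 / 20), ContinuousAt (hcpSumW 2 5) x :=
    fun x hx => (shapeModulus_hcpSumE_hasDerivAt 3 le_rfl (hI x hx).1).continuousAt
  have he6 : ∀ x ∈ Icc (39 / 50 : ℝ) (17 / 20), ContinuousAt (hcpSumW 2 8) x :=
    fun x hx => (shapeModulus_hcpSumE_hasDerivAt 6 (by norm_num) (hI x hx).1).continuousAt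
  have hS3 : ∀ x ∈ Icc (39 / 50 : ℝ) (17 / 20), 0 < hcpSumS 3 x :=
    fun x hx => hcpSumS_pos' le_rfl (hI x hx).1
  have hS6 : ∀ x ∈ Icc (39 / 50 : ℝ) (17 / 20), 0 < hcpSumS 6 x :=
    fun x hx => hcpSumS_pos' (by norm_num) (hI x hx).1
  -- the Fermat function and its derivative `x · P(x)`
  have hF : ∀ x ∈ Icc (39 / 50 : ℝ) (17 / 20),
      HasDerivAt (fun t => hcpSumS 6 t * hcpSumW 1 4 t - hcpSumS 3 t * hcpSumW 1 7 t)
        (x * (14 * hcpSumS 3 x * hcpSumW 2 8 x - 8 * hcpSumS 6 x * hcpSumW 2 5 x -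
          6 * hcpSumW 1 4 x * hcpSumW 1 7 x)) x := by
    intro x hx
    refine (((h6 x hx).mul (hd3 x hx)).sub ((h3 x hx).mul (hd6 x hx))).congr_deriv ?_
    ring
  -- a positive lower bound for `F'` on the box, by compactness
  have hPcont : ContinuousOn (fun x => x * (14 * hcpSumS 3 x * hcpSumW 2 8 x -
      8 * hcpSumS 6 x * hcpSumW 2 5 x - 6 * hcpSumW 1 4 x * hcpSumW 1 7 x))
      (Icc (39 / 50 : ℝ) (17 / 20)) := by
    intro x hx
    have c3 := (h3 x hx).continuousAt
    have c6 := (h6 x hx).continuousAt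
    have cd3 := (hd3 x hx).continuousAt
    have cd6 := (hd6 x hx).continuousAt
    have ce3 := he3 x hx
    have ce6 := he6 x hx
    exact (continuousAt_id.mul ((((continuousAt_const.mul c3).mul ce6).sub
      ((continuousAt_const.mul c6).mul ce3)).sub ((continuousAt_const.mul cd3).mul cd6))
      ).continuousWithinAt
  obtain ⟨m, hm, hmle⟩ := (isCompact_Icc (a := (39 / 50 : ℝ)) (b := 17 / 20)).exists_forall_le'
    hPcont (a := 0) fun x hx =>
      mul_pos (hI x hx).1 (shape_fermat_pos x (hI x hx).2.1 (hI x hx).2.2)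
  -- a positive lower bound for `12 x S₃/S₆²` on the box
  have hB : 0 < hcpSumS 6 (39 / 50) := hcpSumS_pos' (by norm_num) ha
  have hwle : ∀ x ∈ Icc (39 / 50 : ℝ) (17 / 20),
      12 * (39 / 50) / hcpSumS 6 (39 / 50) ^ 2 ≤ 12 * x * hcpSumS 3 x / hcpSumS 6 x ^ 2 := by
    intro x hx
    have hx0 := (hI x hx).1
    have h13 : 1 ≤ hcpSumS 3 x := hcpSum_one_le_hcpSumS_gen le_rfl hx0
    have h66 : hcpSumS 6 x ≤ hcpSumS 6 (39 / 50) := hcpSumS_antitone_gen (by norm_num) ha hx.1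
    have h6p := hS6 x hx
    rw [div_le_div_iff₀ (by positivity) (by positivity)]
    have e1 : hcpSumS 6 x ^ 2 ≤ hcpSumS 6 (39 / 50) ^ 2 := pow_le_pow_left₀ h6p.le h66 2
    have e2 : 39 / 50 * 1 ≤ x * hcpSumS 3 x := mul_le_mul hx.1 h13 zero_le_one hx0.le
    have e3 := mul_le_mul e2 e1 (by positivity) (by positivity)
    nlinarith [e3]
  -- the abstract lemma
  have key := shapeModulus_of_fermat (S₃ := hcpSumS 3) (S₆ := hcpSumS 6) (D₃ := hcpSumW 1 4)
    (D₆ := hcpSumW 1 7) ha ⟨hl, hr⟩ hm (by positivity : (0 : ℝ) < 12 * (39 / 50) / hcpSumS 6 (39 / 50) ^ 2)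
    h3 h6 hS3 hS6 hF hmle hwle (fun x hx => hglob x (hI x hx).1)
  refine ⟨c₀, 12 * (39 / 50) / hcpSumS 6 (39 / 50) ^ 2 * m / 2, hl, hr, by positivity, hglob,
    fun c h1 h2 => key c ⟨h1, h2⟩⟩

end Summit.AtomisticToContinuum.Crystallization.Theorems.PricedHcpWindowsShapeModulus

end
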